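import Summits.BirchSwinnertonDyer.Rank1Residual.GaloisImage.ThreeTorsionCubeRootPairing
import Literature.NumberTheory.EllipticCurves.GaloisActionProofs
import Literature.NumberTheory.EllipticCurves.WeilPairing
import Literature.NumberTheory.GaloisRepresentations.AbsGaloisGroup
import HarnessLib

/-!
# The cube-root Weil pairing on `E[3]`: existence with a closed formula
# (cell `b2b-bsdres`, team n1011, seat p02 gen 10 — row T-E3SYMP, file F2b; TOOL)

HONEST FRAMING (cell `b2b-bsdres`, run/shared/lean/b2b/bsd-rank1-residual/, verbatim in every
file): the goal of the cell is to DELETE the COMBINATION-SHAPED residual classes of the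
Birch–Swinnerton-Dyer formula for ALL analytic-rank `≤ 1` elliptic curves over `ℚ` — "full BSD
formula for every rank `≤ 1` curve in class `C`" assembled STRICTLY from published theorems — so
that the rank-`≤ 1` remainder becomes exactly the CONSTRUCTION-SHAPED classes, which are TYPED
(missing-input `Prop`s), NOT attempted. This is not "finishing BSD". Team n1011 (N10 / N11):
research route; no claim beyond the stated classes; labels UNCHANGED; nothing is booked. Theorems
only (no definition, no named fact).

## What this file proves

For an elliptic curve `W/K`, `char K = 0` (ANY model), with `K̄ = AlgebraicClosure K`,
`E[3] = WeierstrassCurve.geomTorsion W 3` and the pair values of file F1 on `W_{K̄}`: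

* `xOf_smul`, `formula_smul` — `Aut(K̄/K)` acts on abscissae, so any function given by the
  cube-root formula satisfies `e (τS) (τT) = τ (e S T)`;
* `exists_basis_partner` — a point `T ≠ O` of `E[3]` has a partner `S ∈ E[3]` with
  `S, S + T, S − T ≠ O` (`#E[3] = 9`, tree `card_torsionPoints_eq_sq_holds`);
* **`exists_cubeRootWeilPairing`** — there is `e : E[3] → E[3] → K̄` with
  (a) `e S T ^ 3 = 1`, (b) bilinear in both variables, (c) `e T T = 1`, (d) non-degenerate,
  (e) `σ • e S T = e (σ • S) (σ • T)` for `σ ∈ Γ_K` — the body of the tree's existential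
  `WeierstrassCurve.exists_weilPairing W 3` (Silverman *AEC* III.8.1 (a)–(d)) VERBATIM — AND
  (N) the closed formula `e S T · B₁ = B₂` whenever `S, T, S + T, S − T ≠ O`;
* `exists_weilPairing_three` — in particular `W.exists_weilPairing 3` by an explicit witness
  (the tree's `exists_weilPairing_holds` proves it for all `m` by divisors; not used here).

Not claimed: equality with the divisor-theoretic pairing; anything for `m ≠ 3`.
References (context): Silverman *AEC* III.8; Serre 1972 §5.3.
-/

noncomputable section

open scoped Classical

open Polynomial WeierstrassCurve WeierstrassCurve.Affine.Point Literature.NumberTheory.EllipticCurves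

namespace Summit.BirchSwinnertonDyer.Rank1Residual.GaloisImage.CubeRootPairing

universe u

variable {K : Type u} [Field K] [CharZero K] (W : WeierstrassCurve K) [W.IsElliptic]

/-! ### §1. Galois acts on abscissae -/

omit [CharZero K] [W.IsElliptic] in
/-- `x(τ P) = τ x(P)` for `τ ∈ Aut(K̄/K)`. [folklore] -/
theorem xOf_smul (τ : AlgebraicClosure K ≃ₐ[K] AlgebraicClosure K)
    (P : (W.baseChange (AlgebraicClosure K)).toAffine.Point) : xOf (τ • P) = τ (xOf P) := by
  rcases P with _ | ⟨x, y, h⟩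
  · rw [← Affine.Point.zero_def, smul_zero, xOf_zero, _root_.map_zero]
  · rfl

omit [CharZero K] [W.IsElliptic] in
/-- `τ b₄ = b₄` on `W_{K̄}` (`b₄ ∈ K`). [folklore] -/
theorem algEquiv_b₄ (τ : AlgebraicClosure K ≃ₐ[K] AlgebraicClosure K) :
    τ (W.baseChange (AlgebraicClosure K)).b₄ = (W.baseChange (AlgebraicClosure K)).b₄ := by
  rw [WeierstrassCurve.baseChange, WeierstrassCurve.map_b₄]
  exact τ.commutes _

omit [CharZero K] [W.IsElliptic] in
/-- **The cube-root formula is `Aut(K̄/K)`-equivariant**: `e (τS) (τT) = τ (e S T)`. [folklore] -/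
theorem formula_smul {e : (W.baseChange (AlgebraicClosure K)).toAffine.Point →
      (W.baseChange (AlgebraicClosure K)).toAffine.Point → AlgebraicClosure K}
    (he : ∀ S T, e S T = if S ≠ 0 ∧ T ≠ 0 ∧ S + T ≠ 0 ∧ S - T ≠ 0 then
      ((W.baseChange (AlgebraicClosure K)).b₄ - 3 * (xOf S * xOf (S + T) + xOf T * xOf (S - T))) /
        ((W.baseChange (AlgebraicClosure K)).b₄ - 3 * (xOf S * xOf T + xOf (S + T) * xOf (S - T)))
      else 1)
    (τ : AlgebraicClosure K ≃ₐ[K] AlgebraicClosure K)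
    (S T : (W.baseChange (AlgebraicClosure K)).toAffine.Point) :
    e (τ • S) (τ • T) = τ (e S T) := by
  rw [he, he S T, ← smul_add, ← smul_sub]
  simp only [ne_eq, smul_eq_zero_iff_eq]
  by_cases h : ¬S = 0 ∧ ¬T = 0 ∧ ¬S + T = 0 ∧ ¬S - T = 0
  · rw [if_pos h, if_pos h]
    simp only [map_div₀, map_sub, map_add, map_mul, map_ofNat, xOf_smul, algEquiv_b₄]
  · rw [if_neg h, if_neg h, map_one]

/-! ### §2. A partner for every non-zero point of `E[3]` -/

/-- **Every `T` in `E[3]` has a basis partner**: there is `S` with `3S = 0` and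
`S, S + T, S − T ≠ O` (otherwise `E[3] ⊆ {O, T, −T}`, contradicting `#E[3] = 9`).
[cite: SilvermanAEC2009, Cor. III.6.4(b)] -/
theorem exists_basis_partner {T : (W.baseChange (AlgebraicClosure K)).toAffine.Point}
    (hT : (3 : ℤ) • T = 0) :
    ∃ S : (W.baseChange (AlgebraicClosure K)).toAffine.Point,
      (3 : ℤ) • S = 0 ∧ S ≠ 0 ∧ S + T ≠ 0 ∧ S - T ≠ 0 := by
  by_contra hc
  push Not at hc
  have h3 : ((3 : ℕ) : AlgebraicClosure K) ≠ 0 := by norm_num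
  have hcard : Nat.card (geomTorsion W (3 : ℤ)) = 3 ^ 2 :=
    card_torsionPoints_eq_sq_holds W (AlgebraicClosure K) (n := 3) h3
  have mem : ∀ {P : (W.baseChange (AlgebraicClosure K)).toAffine.Point}, (3 : ℤ) • P = 0 →
      (P : geomPoints W) ∈ geomTorsion W (3 : ℤ) := fun hP =>
    (Submodule.mem_torsionBy_iff _ _).mpr hP
  have mem' : ∀ {P : geomPoints W}, P ∈ geomTorsion W (3 : ℤ) →
      (3 : ℤ) • (show (W.baseChange (AlgebraicClosure K)).toAffine.Point from P) = 0 := fun hP =>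
    (Submodule.mem_torsionBy_iff _ _).mp hP
  let g : Fin 3 → geomTorsion W (3 : ℤ) := fun i =>
    match i with
    | 0 => 0
    | 1 => ⟨_, mem hT⟩
    | 2 => ⟨_, mem (three_smul_neg hT)⟩
  have hg : Function.Surjective g := by
    rintro ⟨P, hP⟩
    have hP3 := mem' hP
    by_cases h0 : (show (W.baseChange (AlgebraicClosure K)).toAffine.Point from P) = 0
    · exact ⟨0, Subtype.ext h0.symm⟩
    by_cases h1 : (show (W.baseChange (AlgebraicClosure K)).toAffine.Point from P) + T = 0
    · exact ⟨2, Subtype.ext (eq_neg_of_add_eq_zero_left h1).symm⟩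
    · exact ⟨1, Subtype.ext (sub_eq_zero.mp (hc _ hP3 h0 h1)).symm⟩
  have hle := Nat.card_le_card_of_surjective g hg
  rw [hcard, Nat.card_eq_fintype_card, Fintype.card_fin] at hle
  norm_num at hle

/-! ### §3. The pairing -/

/-- **The cube-root Weil pairing on `E[3]` exists, with its closed formula.** There is
`e : E[3] → E[3] → K̄` which (a) takes values in `μ₃`, (b) is bilinear, (c) alternating,
(d) non-degenerate, (e) `Γ_K`-equivariant — the body of `WeierstrassCurve.exists_weilPairing W 3`
(Silverman *AEC* III.8.1 (a)–(d)) — and (N) satisfies `e S T · B₁ = B₂` for the pair values of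
every basis `S, T` (`S, T, S + T, S − T ≠ O`).
[cite: SilvermanAEC2009, Prop. III.8.1 (a)–(d)] -/
theorem exists_cubeRootWeilPairing :
    ∃ e : geomTorsion W 3 → geomTorsion W 3 → AlgebraicClosure K,
      (∀ S T, e S T ^ 3 = 1) ∧
      (∀ S₁ S₂ T, e (S₁ + S₂) T = e S₁ T * e S₂ T) ∧
      (∀ S T₁ T₂, e S (T₁ + T₂) = e S T₁ * e S T₂) ∧
      (∀ T, e T T = 1) ∧
      (∀ T, (∀ S, e S T = 1) → T = 0) ∧
      (∀ (σ : Field.absoluteGaloisGroup K) (S T : geomTorsion W 3),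
        σ • e S T = e (σ • S) (σ • T)) ∧
      (∀ S T : geomTorsion W 3, (S : geomPoints W) ≠ 0 → (T : geomPoints W) ≠ 0 →
        ((S + T : geomTorsion W 3) : geomPoints W) ≠ 0 →
        ((S - T : geomTorsion W 3) : geomPoints W) ≠ 0 →
        e S T * ((W.baseChange (AlgebraicClosure K)).b₄ -
            3 * (xOf (W := W.baseChange (AlgebraicClosure K)) (S : geomPoints W) *
                xOf (W := W.baseChange (AlgebraicClosure K)) (T : geomPoints W) +
              xOf (W := W.baseChange (AlgebraicClosure K)) ((S + T : geomTorsion W 3) : geomPoints W) *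
                xOf (W := W.baseChange (AlgebraicClosure K)) ((S - T : geomTorsion W 3) : geomPoints W))) =
          (W.baseChange (AlgebraicClosure K)).b₄ -
            3 * (xOf (W := W.baseChange (AlgebraicClosure K)) (S : geomPoints W) *
                xOf (W := W.baseChange (AlgebraicClosure K)) ((S + T : geomTorsion W 3) : geomPoints W) +
              xOf (W := W.baseChange (AlgebraicClosure K)) (T : geomPoints W) *
                xOf (W := W.baseChange (AlgebraicClosure K)) ((S - T : geomTorsion W 3) : geomPoints W))) := by
  -- the formula on points of `W_{K̄}` (`geomPoints W` is by definition this type of points)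
  set e₀ : (W.baseChange (AlgebraicClosure K)).toAffine.Point →
      (W.baseChange (AlgebraicClosure K)).toAffine.Point → AlgebraicClosure K := fun S T =>
    if S ≠ 0 ∧ T ≠ 0 ∧ S + T ≠ 0 ∧ S - T ≠ 0 then
      ((W.baseChange (AlgebraicClosure K)).b₄ - 3 * (xOf S * xOf (S + T) + xOf T * xOf (S - T))) /
        ((W.baseChange (AlgebraicClosure K)).b₄ - 3 * (xOf S * xOf T + xOf (S + T) * xOf (S - T)))
    else 1 with he₀_def
  have he₀ : ∀ S T, e₀ S T = if S ≠ 0 ∧ T ≠ 0 ∧ S + T ≠ 0 ∧ S - T ≠ 0 then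
      ((W.baseChange (AlgebraicClosure K)).b₄ - 3 * (xOf S * xOf (S + T) + xOf T * xOf (S - T))) /
        ((W.baseChange (AlgebraicClosure K)).b₄ - 3 * (xOf S * xOf T + xOf (S + T) * xOf (S - T)))
      else 1 := fun S T => rfl
  -- membership in `E[3]`, read on points of `W_{K̄}`
  have mem3 : ∀ P : geomTorsion W 3,
      (3 : ℤ) • (show (W.baseChange (AlgebraicClosure K)).toAffine.Point from (P : geomPoints W)) = 0 :=
    fun P => (Submodule.mem_torsionBy_iff _ _).mp P.2
  -- point-level versions of the three composite statements
  have addRight : ∀ s t₁ t₂ : (W.baseChange (AlgebraicClosure K)).toAffine.Point, (3 : ℤ) • s = 0 →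
      (3 : ℤ) • t₁ = 0 → (3 : ℤ) • t₂ = 0 → e₀ s (t₁ + t₂) = e₀ s t₁ * e₀ s t₂ := by
    intro s t₁ t₂ hs ht₁ ht₂
    rw [formula_swap he₀ (three_smul_add ht₁ ht₂) hs, formula_add_left he₀ ht₁ ht₂ hs, mul_inv,
      ← formula_swap he₀ ht₁ hs, ← formula_swap he₀ ht₂ hs]
  have basisN : ∀ s t : (W.baseChange (AlgebraicClosure K)).toAffine.Point, (3 : ℤ) • s = 0 →
      (3 : ℤ) • t = 0 → s ≠ 0 → t ≠ 0 → s + t ≠ 0 → s - t ≠ 0 →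
      e₀ s t * ((W.baseChange (AlgebraicClosure K)).b₄ -
          3 * (xOf s * xOf t + xOf (s + t) * xOf (s - t))) =
        (W.baseChange (AlgebraicClosure K)).b₄ - 3 * (xOf s * xOf (s + t) + xOf t * xOf (s - t)) := by
    intro s t hs ht h₁ h₂ h₃ h₄
    obtain ⟨hB₁, -⟩ := cubeRoots_of_sum_eq_zero (pairValues_sum_eq_zero hs ht h₁ h₂ h₃ h₄)
      (pairValues_sum_mul_eq_zero hs ht h₁ h₂ h₃ h₄) (pairValues_prod_eq_Δ hs ht h₁ h₂ h₃ h₄)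
      (W.baseChange (AlgebraicClosure K)).isUnit_Δ.ne_zero
    rw [he₀, if_pos ⟨h₁, h₂, h₃, h₄⟩, div_mul_cancel₀ _ hB₁]
  refine ⟨fun S T => e₀ (S : geomPoints W) (T : geomPoints W), fun S T => ?_, fun S₁ S₂ T => ?_,
    fun S T₁ T₂ => ?_, fun T => ?_, fun T hT => ?_, fun σ S T => ?_, fun S T h₁ h₂ h₃ h₄ => ?_⟩
  · exact formula_pow_three he₀ (mem3 S) (mem3 T)
  · exact formula_add_left he₀ (mem3 S₁) (mem3 S₂) (mem3 T)
  · exact addRight _ _ _ (mem3 S) (mem3 T₁) (mem3 T₂)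
  · exact formula_self he₀ _
  · -- non-degeneracy
    by_contra hT0
    have hT0' : (show (W.baseChange (AlgebraicClosure K)).toAffine.Point from (T : geomPoints W)) ≠ 0 :=
      fun h => hT0 (Subtype.ext h)
    obtain ⟨S, hS3, hS0, hS1, hS2⟩ := exists_basis_partner W (mem3 T)
    have hSmem : (show geomPoints W from S) ∈ geomTorsion W 3 :=
      (Submodule.mem_torsionBy_iff _ _).mpr hS3
    exact (formula_basis he₀ hS3 (mem3 T) hS0 hT0' hS1 hS2).2.1 (hT ⟨_, hSmem⟩)
  · -- Galois equivariance (`σ` acts on abscissae)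
    exact (formula_smul W he₀ (Field.absoluteGaloisGroup.toAlgEquiv K σ) (S : geomPoints W)
      (T : geomPoints W)).symm
  · exact basisN _ _ (mem3 S) (mem3 T) h₁ h₂ h₃ h₄

omit [W.IsElliptic] in
/-- **`W.exists_weilPairing 3` by an explicit witness** (the cube-root pairing).
[cite: SilvermanAEC2009, Prop. III.8.1] -/
theorem exists_weilPairing_three : W.exists_weilPairing 3 := by
  intro _ _ _ _
  obtain ⟨e, ha, hb₁, hb₂, hc, hd, hg, -⟩ := exists_cubeRootWeilPairing W
  exact ⟨e, ha, hb₁, hb₂, hc, hd, hg⟩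

end Summit.BirchSwinnertonDyer.Rank1Residual.GaloisImage.CubeRootPairing

end
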